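import Summits.QuantumFields.BalabanUV.Beta.MultiscaleGradientForward

/-!
# `Summit.QuantumFields.BalabanUV.Beta.MultiscaleGradientL2Mixed` — engine file 20f: the MIXED second-order ℓ² member (3.46)₅'s SHAPE
# for `levelOp` — `‖1_{b₋ ∈ cell k}D(levelOp)⁻¹D*λ‖₂ ≤ 2(C + d·e⁴c_max²)/μ₀·e^{4dκ}·e^{−κd_n(t_k,t_{k′})}·‖λ‖₂` for bond fields `λ` on the
# bonds starting in cell `k′`: NO power of the scale (print's «1»), EVERY isometric transport, from file 20a's conjugated coercivity
# with the Dirichlet term and file 20b's commutator, the source now entering through `D* = Dᵀ`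

HONEST FRAMING (page 1 of everything in this cell).  Discharging `FlowStep.BetaPertH` would make Bałaban's ultraviolet
stability UNCONDITIONAL — a constructive-QFT result; it is NOT the continuum limit and NOT the Clay problem.  This module
discharges nothing of `BetaPertH`; it is [folklore] finite-dimensional bookkeeping about the MODEL operator, kernel-checked, by the
OWNER of binder row D4 (unit `b2b-balaban-beta-an4`, gen 46).  HONEST DEPENDENCY: continuum YM on T⁴ ⇐ BetaPertH ∧ nine spine
estimates (0/9 proved); BetaPertH ⇐ (D1) ∧ (D4) ∧ CAP+tail; G-an2-4 gates asym, D1 and NE2/3/4.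

THE POINT (O.2 item (i), MODEL level; NOT the critical path).  [B9] Thm 3.1 (3.46) p. 398: «‖hG′(U)λ‖, ‖h∇_UG′(U)λ‖, ‖hG′(U)∇*_Uλ‖,
‖h∇_U∇_UG′(U)λ‖, ‖h∇_UG′(U)∇*_Uλ‖, ‖hG′(U)∇*_U∇*_Uλ‖ ≤ B₀[(L^jη)², L^jη, L^jη, 1, 1, 1]|h|e^{−δ₀d(y,y′)}‖λ‖».  Files 5–8 gave the first
member, 20c∕20d the second and third, all for EVERY isometric transport.  THIS FILE gives the FIFTH, `∇_UG′∇*_U`, the one second-order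
member that is GEOMETRY-FREE (the pure ones `∇∇G′`, `G′∇*∇*` need flatness or small curvature — Weitzenböck): with `w = A⁻¹D*λ`,
`g = e^{κρ}w` and the pairing `X = ⟨e^{κρ}g, A(e^{−κρ}g)⟩ = ⟨e^{κρ}g, D*λ⟩ = ⟨D(e^{κρ}g), λ⟩` (`sum_covDT_mul`), file 20e's FORWARD commutator
bound on the support of `λ` gives `X ≤ ‖λ‖·√(2e^{4dκ}X(C + de⁴c_max²κ²)/μ₀)` using `μ₀‖Dg‖² ≤ CX` (20a `hgrad_levelOp`) and `Σμg² ≤ X`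
(`hc_levelOp`), hence `X ≤ 2e^{4dκ}(C + de⁴c_max²)‖λ‖²/μ₀`; the target side is 20b's `bond_sum_commutator_le` exactly as in 20c.
**`real_cellMixed_levelOp_inverse_le`**: constants `d, c_max, C, μ₀, κ` only, no scale factor at all.  WHAT THIS IS NOT: nothing of
Bałaban's ∇_UG′(U)∇*_U; (3.46) is a LOCATOR; row D4 readiness width 0; D4 DISCHARGE NO DATE.

WHAT IS CERTIFIED (kernel, 0 sorry, 0 def): `pairing_le_of_bond_source` (source side), **`real_cellMixed_levelOp_inverse_le`** (the forward
commutator tools are file 20e `MultiscaleGradientForward`; the backward ones file 20b `MultiscaleGradientCommutator`).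
LOCATORS (shape only; ABSOLUTE RULE — nothing printed is asserted): [Balaban1985BackgroundPropagators] Thm 3.1 (3.46) p. 398, (3.8) p. 392.
NOT BetaPertH, NOT continuum, NOT Clay, NOT summit progress.
-/

open scoped BigOperators
open Finset

namespace Summit.QuantumFields.BalabanUV.Beta.MultiscaleGradientL2Mixed

open Summit.QuantumFields.BalabanUV.Beta.BoxPoincare (Box)
open Summit.QuantumFields.BalabanUV.Beta.MultiscaleCoerciveTorus
open Summit.QuantumFields.BalabanUV.Beta.MultiscaleConjError (siteSq siteSq_nonneg)
open Summit.QuantumFields.BalabanUV.Beta.MultiscaleDistance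
open Summit.QuantumFields.BalabanUV.Beta.MultiscaleDecayBudget
open Summit.QuantumFields.BalabanUV.Beta.MultiscaleDecay (hc_levelOp decay_levelOp)
open Summit.QuantumFields.BalabanUV.Beta.MultiscaleGradientCoercive (hgrad_levelOp)
open Summit.QuantumFields.BalabanUV.Beta.MultiscaleGradientCommutator (covD_expW bond_sum_commutator_le)
open Summit.QuantumFields.BalabanUV.Beta.MultiscaleAveragingPointwise (isometry_sq_sum)
open Summit.QuantumFields.BalabanUV.Beta.AccretiveCombesThomasSandwichSite (sdist_corner_thresholds)
open Literature.MathematicalPhysics.QuantumFieldTheory.Balaban1983to89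
open Literature.MathematicalPhysics.QuantumFieldTheory.Balaban1983to89.B9Thm37Glue (covD covDT covD_apply sum_covDT_mul)
open Literature.MathematicalPhysics.QuantumFieldTheory.Balaban1983to89.B9Thm37GluePU (bsrc btgt bsrc_apply btgt_apply)
open Literature.MathematicalPhysics.QuantumFieldTheory.Balaban1983to89.B9Thm37GlueTorusCov (tblk)
open Literature.MathematicalPhysics.QuantumFieldTheory.Balaban1983to89.B9Thm37GlueTorusCovLevels (levelOp)
open Literature.MathematicalPhysics.QuantumFieldTheory.Balaban1983to89.B9Thm37GlueTorusCovCT (expW expW_apply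
  sum_comp_le_of_card_fiber_le card_filter_btgt_le)
open Summit.QuantumFields.BalabanUV.T4Continuum.RegionGaugeSliceOrth (le_of_le_sqrt_mul_sqrt)
open B5TorusCover (UT Ctr ctrU)

noncomputable section

open Summit.QuantumFields.BalabanUV.Beta.MultiscaleGradientForward (bond_sum_forward_le)

/-! ## THE MIXED MEMBER (3.46)₅'s SHAPE FOR `levelOp`, CELL TO CELL, EVERY ISOMETRIC TRANSPORT -/

section Member

variable {d : ℕ} {N : Fin d → ℕ} [∀ i, NeZero (N i)] [NeZero d] {Cp J K : Type} [Fintype Cp] [DecidableEq Cp] [Nonempty Cp]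
  [Fintype J] [Fintype K] [DecidableEq K] (S : J → ℕ) (hS : ∀ l, 1 ≤ S l) (hdivS : ∀ l i, S l ∣ N i) (lvl : K → J)
  (zc : (k : K) → Ctr N (S (lvl k)))
  (hdisj : ∀ k k' v v', cellPt S hS hdivS lvl zc k v = cellPt S hS hdivS lvl zc k' v' → k = k')
  (hcover : ∀ x : UT N, ∃ k, ∃ v : Box d (S (lvl k)), cellPt S hS hdivS lvl zc k v = x)
  (Rm : UT N × Fin d → Cp → Cp → ℝ) (hRm : ∀ b i j, ∑ k, Rm b k i * Rm b k j = if i = j then (1 : ℝ) else 0)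
  (T : J → UT N → Cp → Cp → ℝ) (hT : ∀ l x i i', ∑ k, T l x k i * T l x k i' = if i = i' then (1 : ℝ) else 0)
  (a : J → ℝ) (ha : ∀ j, 0 ≤ a j) (ω : J → UT N → ℝ)
  (hsupp : ∀ l x, ω l (ctrU N (S l) (tblk (hS l) (hdivS l) x)) ≠ 0 → ∃ k v, lvl k = l ∧ cellPt S hS hdivS lvl zc k v = x)
  {amax : ℝ} (hamax : 0 ≤ amax)
  (hscale : ∀ k, a (lvl k) * ω (lvl k) (ctrU N (S (lvl k)) (zc k)) ^ 2 * (S (lvl k) : ℝ) ^ d ≤ amax / (S (lvl k) : ℝ) ^ 2)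
  (c : UT N × Fin d → ℝ) {cmax : ℝ} (hc : ∀ b, |c b| ≤ cmax) {C : ℝ}
  (hcoer : ∀ f : UT N × Cp → ℝ,
    C * ∑ k, ((S (lvl k) : ℝ) ^ 2)⁻¹ * ∑ v : Box d (S (lvl k)), ∑ i, f (cellPt S hS hdivS lvl zc k v, i) ^ 2 ≤
      ∑ p, f p * levelOp bsrc btgt c Rm (fun l x => ctrU N (S l) (tblk (hS l) (hdivS l) x))
        (fun l x => ω l (ctrU N (S l) (tblk (hS l) (hdivS l) x))) T a f p)
  {κ : ℝ} (hκ0 : 0 ≤ κ) (hκ1 : κ ≤ 1)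

include hdisj hRm hT ha hsupp hamax hscale hc hcoer hκ0 hκ1

/-- **SOURCE SIDE: the conjugated pairing of `g = e^{κρ}w`, `ρ = d_n(·,t_{k′})`, for ANY `w` with `levelOp w = D*λ` and `λ` on the
bonds starting in cell `k′`, is at most `2e^{4dκ}·(C + d·e⁴·c_max²)/μ₀·‖λ‖₂²`** — `⟨e^{κρ}g, levelOp(e^{−κρ}g)⟩ = ⟨D(e^{κρ}g), λ⟩`
(`sum_covDT_mul`), Cauchy–Schwarz on the support of `λ`, 20e's `bond_sum_forward_le` with the ceiling `κ·2d` on cell `k′`, and 20a's `hgrad_levelOp` ∕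
`hc_levelOp` at `v = g`. [folklore] -/
theorem pairing_le_of_bond_source (hμ : 0 < C - 2 * d * cmax ^ 2 * κ ^ 2 - amax * (Real.exp (2 * d * κ) - 1))
    (k' : K) (lam : (UT N × Fin d) × Cp → ℝ) (hlam : ∀ q, cellOf S hS hdivS lvl zc hcover (bsrc q.1) ≠ k' → lam q = 0)
    (w : UT N × Cp → ℝ)
    (hAw : levelOp bsrc btgt c Rm (fun l x => ctrU N (S l) (tblk (hS l) (hdivS l) x))
      (fun l x => ω l (ctrU N (S l) (tblk (hS l) (hdivS l) x))) T a w = covDT bsrc btgt c Rm lam) :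
    ∑ p, Real.exp (κ * sdist bsrc btgt (siteScale S hS hdivS lvl zc hcover) p.1 (ctrU N (S (lvl k')) (zc k'))) *
        (Real.exp (κ * sdist bsrc btgt (siteScale S hS hdivS lvl zc hcover) p.1 (ctrU N (S (lvl k')) (zc k'))) * w p) *
        levelOp bsrc btgt c Rm (fun l x => ctrU N (S l) (tblk (hS l) (hdivS l) x))
          (fun l x => ω l (ctrU N (S l) (tblk (hS l) (hdivS l) x))) T a
          (fun q => Real.exp (-(κ * sdist bsrc btgt (siteScale S hS hdivS lvl zc hcover) q.1 (ctrU N (S (lvl k')) (zc k')))) *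
            (Real.exp (κ * sdist bsrc btgt (siteScale S hS hdivS lvl zc hcover) q.1 (ctrU N (S (lvl k')) (zc k'))) * w q)) p ≤
      2 * Real.exp (2 * (2 * d * κ)) *
        ((C + d * Real.exp 1 ^ 4 * cmax ^ 2) / (C - 2 * d * cmax ^ 2 * κ ^ 2 - amax * (Real.exp (2 * d * κ) - 1))) *
        ∑ b ∈ univ.filter (fun b : UT N × Fin d => cellOf S hS hdivS lvl zc hcover (bsrc b) = k'), ∑ i, lam (b, i) ^ 2 := by
  classical
  obtain ⟨i₀⟩ := ‹Nonempty Cp›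
  set μ₀ := C - 2 * d * cmax ^ 2 * κ ^ 2 - amax * (Real.exp (2 * d * κ) - 1) with hμ₀
  set Aop := levelOp bsrc btgt c Rm (fun l x => ctrU N (S l) (tblk (hS l) (hdivS l) x))
    (fun l x => ω l (ctrU N (S l) (tblk (hS l) (hdivS l) x))) T a with hAop
  set n := siteScale S hS hdivS lvl zc hcover with hn
  set tk' : UT N := ctrU N (S (lvl k')) (zc k') with htk'
  set ρ : UT N × Cp → ℝ := fun p => sdist bsrc btgt n p.1 tk' with hρ
  set φ : UT N → ℝ := fun x => κ * sdist bsrc btgt n x tk' with hφ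
  set Bd' := univ.filter (fun b : UT N × Fin d => cellOf S hS hdivS lvl zc hcover (bsrc b) = k') with hBd'
  set Ke : ℝ := C + d * Real.exp 1 ^ 4 * cmax ^ 2 with hKe
  set g : UT N × Cp → ℝ := fun p => Real.exp (κ * ρ p) * w p with hg
  set X : ℝ := ∑ p, Real.exp (κ * ρ p) * g p * Aop (fun q => Real.exp (-(κ * ρ q)) * g q) p with hX
  show X ≤ 2 * Real.exp (2 * (2 * d * κ)) * (Ke / μ₀) * ∑ b ∈ Bd', ∑ i, lam (b, i) ^ 2
  -- positivity
  have hd0 : (0 : ℝ) < d := by exact_mod_cast Nat.pos_of_ne_zero (NeZero.ne d)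
  have hn0 : ∀ x, (0 : ℝ) < (n x : ℝ) := fun x => by exact_mod_cast one_le_siteScale S hS hdivS lvl zc hcover x
  have hC : 0 < C := by
    have h1 : 0 ≤ 2 * (d : ℝ) * cmax ^ 2 * κ ^ 2 := by positivity
    have h2 : 0 ≤ amax * (Real.exp (2 * d * κ) - 1) := by
      refine mul_nonneg hamax ?_
      have : 0 ≤ 2 * (d : ℝ) * κ := by positivity
      linarith [Real.one_le_exp_iff.mpr this]
    linarith
  have hKe0 : 0 < Ke := by rw [hKe]; positivity
  have hg' : g = expW φ w := by funext p; rw [hg, hφ, hρ]; rfl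
  have hback : (fun q => Real.exp (-(κ * ρ q)) * g q) = w := by
    funext q; rw [hg]; simp only
    rw [← mul_assoc, ← Real.exp_add, show -(κ * ρ q) + κ * ρ q = 0 by ring, Real.exp_zero, one_mul]
  -- hc_levelOp and hgrad_levelOp at `v = g`
  set μ : UT N × Cp → ℝ := fun p => μ₀ * ((n p.1 : ℝ) ^ 2)⁻¹ with hμdef
  have hPg : ∑ p, μ p * g p ^ 2 ≤ X := by
    have h := hc_levelOp S hS hdivS lvl zc hdisj hcover Rm hRm T hT a ha ω hsupp hamax hscale c hc hcoer hκ0 hκ1 (tk', i₀) g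
    rw [← hμ₀, ← hAop] at h
    refine le_trans (le_of_eq (Finset.sum_congr rfl fun p _ => ?_)) h
    rw [hμdef]
  have hDg : μ₀ * ∑ q, (covD bsrc btgt c Rm g q) ^ 2 ≤ C * X := by
    have h := hgrad_levelOp S hS hdivS lvl zc hdisj hcover Rm hRm T hT a ha ω hsupp hamax hscale c hc hcoer hκ0 hκ1 hμ (tk', i₀) g
    rw [← hμ₀, ← hAop] at h
    exact h
  have hPg0 : 0 ≤ ∑ p, μ p * g p ^ 2 :=
    Finset.sum_nonneg fun p _ => mul_nonneg (mul_pos hμ (inv_pos.mpr (pow_pos (hn0 p.1) 2))).le (sq_nonneg _)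
  have hX0 : 0 ≤ X := hPg0.trans hPg
  -- `X = ⟨D(e^{φ}g), λ⟩`
  have hXeq : X = ∑ q, lam q * covD bsrc btgt c Rm (expW φ g) q := by
    have h1 : X = ∑ p, covDT bsrc btgt c Rm lam p * (expW φ g) p := by
      rw [hX, hback, hAw]
      refine Finset.sum_congr rfl fun p _ => ?_
      rw [expW_apply, hφ, hρ]; simp only; ring
    rw [h1, sum_covDT_mul]
  -- the profile mass in site form
  have hmass : ∑ x, ((n x : ℝ) ^ 2)⁻¹ * siteSq g x ≤ X / μ₀ := by
    rw [le_div_iff₀ hμ]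
    have e : (∑ x, ((n x : ℝ) ^ 2)⁻¹ * siteSq g x) * μ₀ = ∑ p, μ p * g p ^ 2 := by
      rw [Fintype.sum_prod_type, Finset.sum_mul]
      refine Finset.sum_congr rfl fun x _ => ?_
      unfold siteSq
      rw [Finset.mul_sum, Finset.sum_mul]
      refine Finset.sum_congr rfl fun i _ => ?_
      rw [hμdef]; ring
    rw [e]; exact hPg
  -- 20e on the support of `λ` with the ceiling `κ·2d`
  have hφb : ∀ b : UT N × Fin d, |φ (btgt b) - φ (bsrc b)| ≤ κ * slen n (bsrc b) (btgt b) := by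
    intro b; rw [hφ]; simp only
    rw [← mul_sub, abs_mul, abs_of_nonneg hκ0]
    exact mul_le_mul_of_nonneg_left (abs_sdist_tgt_sub_src_le bsrc btgt n b tk') hκ0
  have hthr := sdist_corner_thresholds S hS hdivS lvl zc hdisj hcover
  have hceil : ∀ b ∈ Bd', φ (bsrc b) ≤ 2 * d * κ := by
    intro b hb
    have hbk : cellOf S hS hdivS lvl zc hcover (bsrc b) = k' := (mem_filter.mp hb).2
    rw [hφ]; simp only
    have h := (hthr (bsrc b) k').1 hbk
    rw [htk']
    nlinarith [mul_le_mul_of_nonneg_left h hκ0]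
  have hfwd := bond_sum_forward_le S hS hdivS lvl zc hcover Rm hRm c hc hκ0 hκ1 φ hφb g Bd' hceil
  -- Cauchy–Schwarz on the support set `BdC = Bd′ × Cp`
  set BdC := univ.filter (fun q : (UT N × Fin d) × Cp => cellOf S hS hdivS lvl zc hcover (bsrc q.1) = k') with hBdC
  have hiter : ∀ (Ψ : (UT N × Fin d) × Cp → ℝ), ∑ q ∈ BdC, Ψ q = ∑ b ∈ Bd', ∑ i, Ψ (b, i) := by
    intro Ψ
    have hprod : BdC = Bd' ×ˢ (univ : Finset Cp) := by
      ext q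
      rw [hBdC, hBd', mem_filter, Finset.mem_product, mem_filter]
      simp
    rw [hprod, Finset.sum_product]
  have hrestr : ∑ q, lam q * covD bsrc btgt c Rm (expW φ g) q = ∑ q ∈ BdC, lam q * covD bsrc btgt c Rm (expW φ g) q := by
    symm
    refine Finset.sum_subset (Finset.subset_univ BdC) fun q _ hq => ?_
    have : lam q = 0 := hlam q (fun hmem => hq (by rw [hBdC, mem_filter]; exact ⟨mem_univ _, hmem⟩))
    rw [this, zero_mul]
  obtain ⟨Lam2, hLam2⟩ : ∃ t : ℝ, t = ∑ q ∈ BdC, lam q ^ 2 := ⟨_, rfl⟩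
  obtain ⟨Gf2, hGf2⟩ : ∃ t : ℝ, t = ∑ q ∈ BdC, (covD bsrc btgt c Rm (expW φ g) q) ^ 2 := ⟨_, rfl⟩
  have hLam0 : 0 ≤ Lam2 := by rw [hLam2]; exact Finset.sum_nonneg fun q _ => sq_nonneg _
  have hGf20 : 0 ≤ Gf2 := by rw [hGf2]; exact Finset.sum_nonneg fun q _ => sq_nonneg _
  have hcs : X ≤ Real.sqrt Lam2 * Real.sqrt Gf2 := by
    rw [hXeq, hrestr, hLam2, hGf2]
    exact Real.sum_mul_le_sqrt_mul_sqrt BdC lam _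
  -- `Gf2 ≤ M·X`, `M = 2e^{4dκ}Ke/μ₀`
  have hκ2 : κ ^ 2 ≤ 1 := by nlinarith
  obtain ⟨M, hM⟩ : ∃ t : ℝ, t = 2 * Real.exp (2 * (2 * d * κ)) * (Ke / μ₀) := ⟨_, rfl⟩
  have hM0 : 0 ≤ M := by rw [hM]; positivity
  have hGf2_le : Gf2 ≤ M * X := by
    have h1 : Gf2 = ∑ b ∈ Bd', ∑ i, (covD bsrc btgt c Rm (expW φ g) (b, i)) ^ 2 := by rw [hGf2, hiter]
    rw [h1, hM]
    refine hfwd.trans ?_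
    have hDg' : ∑ q, (covD bsrc btgt c Rm g q) ^ 2 ≤ C / μ₀ * X := by
      rw [div_mul_eq_mul_div, le_div_iff₀ hμ]; linarith
    have hA : cmax ^ 2 * Real.exp 1 ^ 4 * κ ^ 2 * (d * ∑ x, ((n x : ℝ) ^ 2)⁻¹ * siteSq g x) ≤
        cmax ^ 2 * Real.exp 1 ^ 4 * 1 * (d * (X / μ₀)) := by
      have h2 := mul_le_mul_of_nonneg_left hmass hd0.le
      have hm0 : 0 ≤ d * ∑ x, ((n x : ℝ) ^ 2)⁻¹ * siteSq g x :=
        mul_nonneg hd0.le (Finset.sum_nonneg fun x _ => mul_nonneg (inv_nonneg.mpr (sq_nonneg _)) (siteSq_nonneg _ x))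
      exact mul_le_mul (mul_le_mul_of_nonneg_left hκ2 (by positivity)) h2 hm0 (by positivity)
    have h3 : C / μ₀ * X + cmax ^ 2 * Real.exp 1 ^ 4 * 1 * (d * (X / μ₀)) = Ke / μ₀ * X := by
      rw [hKe]
      field_simp
    have h4 : 0 ≤ 2 * Real.exp (2 * (2 * d * κ)) := by positivity
    calc 2 * Real.exp (2 * (2 * d * κ)) * (∑ q, (covD bsrc btgt c Rm g q) ^ 2 +
          cmax ^ 2 * Real.exp 1 ^ 4 * κ ^ 2 * (d * ∑ x, ((n x : ℝ) ^ 2)⁻¹ * siteSq g x))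
        ≤ 2 * Real.exp (2 * (2 * d * κ)) * (C / μ₀ * X + cmax ^ 2 * Real.exp 1 ^ 4 * 1 * (d * (X / μ₀))) :=
          mul_le_mul_of_nonneg_left (add_le_add hDg' hA) h4
      _ = 2 * Real.exp (2 * (2 * d * κ)) * (Ke / μ₀) * X := by rw [h3]; ring
  -- hence `X ≤ M·Lam2`
  have hsq : X * X ≤ Lam2 * (M * X) := by
    have h1 : X * X ≤ (Real.sqrt Lam2 * Real.sqrt Gf2) * (Real.sqrt Lam2 * Real.sqrt Gf2) :=
      mul_self_le_mul_self hX0 hcs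
    have h2 : (Real.sqrt Lam2 * Real.sqrt Gf2) * (Real.sqrt Lam2 * Real.sqrt Gf2) = Lam2 * Gf2 := by
      rw [show (Real.sqrt Lam2 * Real.sqrt Gf2) * (Real.sqrt Lam2 * Real.sqrt Gf2) =
        (Real.sqrt Lam2 * Real.sqrt Lam2) * (Real.sqrt Gf2 * Real.sqrt Gf2) by ring,
        Real.mul_self_sqrt hLam0, Real.mul_self_sqrt hGf20]
    rw [h2] at h1
    exact h1.trans (mul_le_mul_of_nonneg_left hGf2_le hLam0)
  have hLam2eq : Lam2 = ∑ b ∈ Bd', ∑ i, lam (b, i) ^ 2 := by rw [hLam2, hiter]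
  rw [← hLam2eq, ← hM]
  by_cases hX00 : X = 0
  · rw [hX00]; positivity
  · have hXpos : 0 < X := lt_of_le_of_ne hX0 (Ne.symm hX00)
    have : X * X ≤ (M * Lam2) * X := by linarith [hsq, show Lam2 * (M * X) = (M * Lam2) * X by ring]
    exact le_of_mul_le_mul_right this hXpos

/-- **THE MIXED SECOND-ORDER ℓ² MEMBER (3.46)₅'s SHAPE FOR `levelOp` — EVERY ISOMETRIC TRANSPORT, NO SCALE FACTOR.**  In the MODEL
setting of `MultiscaleDecay.hc_levelOp` with the margin `μ₀ > 0`, for a bond field `λ` supported on the bonds starting in cell `k′`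
and every cell `k`:
`√(Σ_{b₋ ∈ cell k}Σ_i ((D(levelOp)⁻¹(D*λ))(b,i))²) ≤ 2(C + d·e⁴·c_max²)/μ₀·e^{4dκ}·e^{−κ·d_n(t_k,t_{k′})}·√(Σ_{b₋ ∈ cell k′}Σ_i λ(b,i)²)`
— `pairing_le_of_bond_source` for the source side, 20b's `bond_sum_commutator_le` with the target floor `d_n ≥ d_n(t_k,t_{k′}) − 2d`
for the target side. [cite: Balaban1985BackgroundPropagators, Thm 3.1 (3.46) p.398 + (3.8) p.392] [folklore] -/
theorem real_cellMixed_levelOp_inverse_le (hμ : 0 < C - 2 * d * cmax ^ 2 * κ ^ 2 - amax * (Real.exp (2 * d * κ) - 1))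
    (k' : K) (lam : (UT N × Fin d) × Cp → ℝ) (hlam : ∀ q, cellOf S hS hdivS lvl zc hcover (bsrc q.1) ≠ k' → lam q = 0) (k : K) :
    Real.sqrt (∑ b ∈ univ.filter (fun b : UT N × Fin d => cellOf S hS hdivS lvl zc hcover (bsrc b) = k),
        ∑ i, (covD bsrc btgt c Rm ((Ring.inverse (levelOp bsrc btgt c Rm (fun l x => ctrU N (S l) (tblk (hS l) (hdivS l) x))
          (fun l x => ω l (ctrU N (S l) (tblk (hS l) (hdivS l) x))) T a)) (covDT bsrc btgt c Rm lam)) (b, i)) ^ 2) ≤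
      2 * (C + d * Real.exp 1 ^ 4 * cmax ^ 2) / (C - 2 * d * cmax ^ 2 * κ ^ 2 - amax * (Real.exp (2 * d * κ) - 1)) *
        Real.exp (4 * d * κ) *
        Real.exp (-(κ * sdist bsrc btgt (siteScale S hS hdivS lvl zc hcover)
          (ctrU N (S (lvl k)) (zc k)) (ctrU N (S (lvl k')) (zc k')))) *
        Real.sqrt (∑ b ∈ univ.filter (fun b : UT N × Fin d => cellOf S hS hdivS lvl zc hcover (bsrc b) = k'),
          ∑ i, lam (b, i) ^ 2) := by
  classical
  obtain ⟨i₀⟩ := ‹Nonempty Cp›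
  set μ₀ := C - 2 * d * cmax ^ 2 * κ ^ 2 - amax * (Real.exp (2 * d * κ) - 1) with hμ₀
  set Aop := levelOp bsrc btgt c Rm (fun l x => ctrU N (S l) (tblk (hS l) (hdivS l) x))
    (fun l x => ω l (ctrU N (S l) (tblk (hS l) (hdivS l) x))) T a with hAop
  set n := siteScale S hS hdivS lvl zc hcover with hn
  set tk : UT N := ctrU N (S (lvl k)) (zc k) with htk
  set tk' : UT N := ctrU N (S (lvl k')) (zc k') with htk'
  set w := (Ring.inverse Aop) (covDT bsrc btgt c Rm lam) with hw
  set ρ : UT N × Cp → ℝ := fun p => sdist bsrc btgt n p.1 tk' with hρ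
  set φ : UT N → ℝ := fun x => κ * sdist bsrc btgt n x tk' with hφ
  set Bd := univ.filter (fun b : UT N × Fin d => cellOf S hS hdivS lvl zc hcover (bsrc b) = k) with hBd
  set Bd' := univ.filter (fun b : UT N × Fin d => cellOf S hS hdivS lvl zc hcover (bsrc b) = k') with hBd'
  set D0 : ℝ := sdist bsrc btgt n tk tk' with hD0
  set Ke : ℝ := C + d * Real.exp 1 ^ 4 * cmax ^ 2 with hKe
  set Lam2 : ℝ := ∑ b ∈ Bd', ∑ i, lam (b, i) ^ 2 with hLam2
  -- positivity and units
  have hd0 : (0 : ℝ) < d := by exact_mod_cast Nat.pos_of_ne_zero (NeZero.ne d)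
  have hn0 : ∀ x, (0 : ℝ) < (n x : ℝ) := fun x => by exact_mod_cast one_le_siteScale S hS hdivS lvl zc hcover x
  have hC : 0 < C := by
    have h1 : 0 ≤ 2 * (d : ℝ) * cmax ^ 2 * κ ^ 2 := by positivity
    have h2 : 0 ≤ amax * (Real.exp (2 * d * κ) - 1) := by
      refine mul_nonneg hamax ?_
      have : 0 ≤ 2 * (d : ℝ) * κ := by positivity
      linarith [Real.one_le_exp_iff.mpr this]
    linarith
  have hKe0 : 0 < Ke := by rw [hKe]; positivity
  have hLam0 : 0 ≤ Lam2 := Finset.sum_nonneg fun b _ => Finset.sum_nonneg fun i _ => sq_nonneg _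
  have hunit : IsUnit Aop :=
    (decay_levelOp S hS hdivS lvl zc hdisj hcover Rm hRm T hT a ha ω hsupp hamax hscale c hc hcoer hκ0 hκ1 hμ
      (tk', i₀) (tk', i₀)).1
  have hAw : Aop w = covDT bsrc btgt c Rm lam := by
    rw [hw, ← Module.End.mul_apply, Ring.mul_inverse_cancel _ hunit, Module.End.one_apply]
  -- the conjugating field and the pairing
  set g : UT N × Cp → ℝ := fun p => Real.exp (κ * ρ p) * w p with hg
  have hg' : g = expW φ w := by funext p; rw [hg, hφ, hρ]; rfl
  set X : ℝ := ∑ p, Real.exp (κ * ρ p) * g p * Aop (fun q => Real.exp (-(κ * ρ q)) * g q) p with hX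
  -- SOURCE SIDE
  have hX_le : X ≤ 2 * Real.exp (2 * (2 * d * κ)) * (Ke / μ₀) * Lam2 :=
    pairing_le_of_bond_source S hS hdivS lvl zc hdisj hcover Rm hRm T hT a ha ω hsupp hamax hscale c hc hcoer hκ0 hκ1 hμ k' lam
      hlam w hAw
  -- hc_levelOp and hgrad_levelOp at `v = g`
  set μ : UT N × Cp → ℝ := fun p => μ₀ * ((n p.1 : ℝ) ^ 2)⁻¹ with hμdef
  have hPg : ∑ p, μ p * g p ^ 2 ≤ X := by
    have h := hc_levelOp S hS hdivS lvl zc hdisj hcover Rm hRm T hT a ha ω hsupp hamax hscale c hc hcoer hκ0 hκ1 (tk', i₀) g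
    rw [← hμ₀, ← hAop] at h
    refine le_trans (le_of_eq (Finset.sum_congr rfl fun p _ => ?_)) h
    rw [hμdef]
  have hDg : μ₀ * ∑ q, (covD bsrc btgt c Rm g q) ^ 2 ≤ C * X := by
    have h := hgrad_levelOp S hS hdivS lvl zc hdisj hcover Rm hRm T hT a ha ω hsupp hamax hscale c hc hcoer hκ0 hκ1 hμ (tk', i₀) g
    rw [← hμ₀, ← hAop] at h
    exact h
  have hmass : ∑ x, ((n x : ℝ) ^ 2)⁻¹ * siteSq g x ≤ X / μ₀ := by
    rw [le_div_iff₀ hμ]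
    have e : (∑ x, ((n x : ℝ) ^ 2)⁻¹ * siteSq g x) * μ₀ = ∑ p, μ p * g p ^ 2 := by
      rw [Fintype.sum_prod_type, Finset.sum_mul]
      refine Finset.sum_congr rfl fun x _ => ?_
      unfold siteSq
      rw [Finset.mul_sum, Finset.sum_mul]
      refine Finset.sum_congr rfl fun i _ => ?_
      rw [hμdef]; ring
    rw [e]; exact hPg
  -- TARGET SIDE
  have hφb : ∀ b : UT N × Fin d, |φ (btgt b) - φ (bsrc b)| ≤ κ * slen n (bsrc b) (btgt b) := by
    intro b; rw [hφ]; simp only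
    rw [← mul_sub, abs_mul, abs_of_nonneg hκ0]
    exact mul_le_mul_of_nonneg_left (abs_sdist_tgt_sub_src_le bsrc btgt n b tk') hκ0
  have hthr := sdist_corner_thresholds S hS hdivS lvl zc hdisj hcover
  have hsum := bond_sum_commutator_le S hS hdivS lvl zc hcover Rm hRm c hc hκ0 hκ1 φ hφb w Bd
  rw [← hg'] at hsum
  have hfloor : ∀ b ∈ Bd, κ * (D0 - 2 * d) ≤ φ (bsrc b) := by
    intro b hb
    have hbk : cellOf S hS hdivS lvl zc hcover (bsrc b) = k := (mem_filter.mp hb).2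
    have h2 := (hthr (bsrc b) k').2
    rw [hbk] at h2
    rw [hφ]; simp only
    exact mul_le_mul_of_nonneg_left (by rw [hD0, htk]; linarith) hκ0
  obtain ⟨LHS2, hLHS2⟩ : ∃ t : ℝ, t = ∑ b ∈ Bd, ∑ i, (covD bsrc btgt c Rm w (b, i)) ^ 2 := ⟨_, rfl⟩
  have hLHS0 : 0 ≤ LHS2 := by rw [hLHS2]; exact Finset.sum_nonneg fun b _ => Finset.sum_nonneg fun i _ => sq_nonneg _
  have hL : Real.exp (2 * (κ * (D0 - 2 * d))) * LHS2 ≤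
      ∑ b ∈ Bd, ∑ i, (Real.exp (φ (bsrc b)) * covD bsrc btgt c Rm w (b, i)) ^ 2 := by
    rw [hLHS2, Finset.mul_sum]
    refine Finset.sum_le_sum fun b hb => ?_
    rw [Finset.mul_sum]
    refine Finset.sum_le_sum fun i _ => ?_
    rw [mul_pow, sq (Real.exp _), ← Real.exp_add]
    have : Real.exp (2 * (κ * (D0 - 2 * d))) ≤ Real.exp (φ (bsrc b) + φ (bsrc b)) :=
      Real.exp_le_exp.mpr (by linarith [hfloor b hb])
    exact mul_le_mul_of_nonneg_right this (sq_nonneg _)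
  have hκ2 : κ ^ 2 ≤ 1 := by nlinarith
  have htarget : Real.exp (2 * (κ * (D0 - 2 * d))) * LHS2 ≤ 2 * (Ke / μ₀) * X := by
    have hDg' : ∑ q, (covD bsrc btgt c Rm g q) ^ 2 ≤ C / μ₀ * X := by
      rw [div_mul_eq_mul_div, le_div_iff₀ hμ]; linarith
    have hA : 2 * (cmax ^ 2 * Real.exp 1 ^ 2 * κ ^ 2 * (d * ∑ x, ((n x : ℝ) ^ 2)⁻¹ * siteSq g x)) ≤
        2 * (cmax ^ 2 * Real.exp 1 ^ 4 * 1 * (d * (X / μ₀))) := by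
      have h2 := mul_le_mul_of_nonneg_left hmass hd0.le
      have hm0 : 0 ≤ d * ∑ x, ((n x : ℝ) ^ 2)⁻¹ * siteSq g x :=
        mul_nonneg hd0.le (Finset.sum_nonneg fun x _ => mul_nonneg (inv_nonneg.mpr (sq_nonneg _)) (siteSq_nonneg _ x))
      have he : Real.exp 1 ^ 2 ≤ Real.exp 1 ^ 4 :=
        pow_le_pow_right₀ (Real.one_le_exp (by norm_num)) (by norm_num)
      have hc0 : cmax ^ 2 * Real.exp 1 ^ 2 * κ ^ 2 ≤ cmax ^ 2 * Real.exp 1 ^ 4 * 1 :=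
        mul_le_mul (mul_le_mul_of_nonneg_left he (sq_nonneg _)) hκ2 (sq_nonneg κ) (by positivity)
      linarith [mul_le_mul hc0 h2 hm0 (by positivity)]
    have h3 : 2 * (C / μ₀ * X) + 2 * (cmax ^ 2 * Real.exp 1 ^ 4 * 1 * (d * (X / μ₀))) = 2 * (Ke / μ₀) * X := by
      rw [hKe]
      field_simp
    linarith [hL, hsum, hDg', hA, h3]
  -- assemble
  obtain ⟨Kf, hKf⟩ : ∃ t : ℝ, t = 2 * (Ke / μ₀) * Real.exp (4 * d * κ) * Real.exp (-(κ * D0)) := ⟨_, rfl⟩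
  have hKf0 : 0 ≤ Kf := by rw [hKf]; positivity
  have hE0 : 0 < Real.exp (2 * (κ * (D0 - 2 * d))) := Real.exp_pos _
  have hKf2 : Kf ^ 2 * Real.exp (2 * (κ * (D0 - 2 * d))) = 2 * (Ke / μ₀) * (2 * Real.exp (2 * (2 * d * κ)) * (Ke / μ₀)) := by
    have e3 : (Real.exp (4 * d * κ) * Real.exp (-(κ * D0))) ^ 2 * Real.exp (2 * (κ * (D0 - 2 * d))) =
        Real.exp (2 * (2 * d * κ)) := by
      rw [sq, ← Real.exp_add, ← Real.exp_add, ← Real.exp_add]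
      congr 1
      ring
    calc Kf ^ 2 * Real.exp (2 * (κ * (D0 - 2 * d)))
        = (2 * (Ke / μ₀)) ^ 2 * ((Real.exp (4 * d * κ) * Real.exp (-(κ * D0))) ^ 2 * Real.exp (2 * (κ * (D0 - 2 * d)))) := by
          rw [hKf]; ring
      _ = 2 * (Ke / μ₀) * (2 * Real.exp (2 * (2 * d * κ)) * (Ke / μ₀)) := by rw [e3]; ring
  have hsq' : LHS2 ≤ Kf ^ 2 * Lam2 := by
    have h : Real.exp (2 * (κ * (D0 - 2 * d))) * LHS2 ≤ Real.exp (2 * (κ * (D0 - 2 * d))) * (Kf ^ 2 * Lam2) := by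
      calc Real.exp (2 * (κ * (D0 - 2 * d))) * LHS2 ≤ 2 * (Ke / μ₀) * X := htarget
        _ ≤ 2 * (Ke / μ₀) * (2 * Real.exp (2 * (2 * d * κ)) * (Ke / μ₀) * Lam2) := mul_le_mul_of_nonneg_left hX_le (by positivity)
        _ = Kf ^ 2 * Real.exp (2 * (κ * (D0 - 2 * d))) * Lam2 := by rw [hKf2]; ring
        _ = Real.exp (2 * (κ * (D0 - 2 * d))) * (Kf ^ 2 * Lam2) := by ring
    exact le_of_mul_le_mul_left h hE0
  rw [← hLHS2]
  calc Real.sqrt LHS2 ≤ Real.sqrt (Kf ^ 2 * Lam2) := Real.sqrt_le_sqrt hsq'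
    _ = Kf * Real.sqrt Lam2 := by rw [Real.sqrt_mul (sq_nonneg _), Real.sqrt_sq hKf0]
    _ = 2 * Ke / μ₀ * Real.exp (4 * d * κ) * Real.exp (-(κ * D0)) * Real.sqrt Lam2 := by rw [hKf]; ring

end Member

end

end Summit.QuantumFields.BalabanUV.Beta.MultiscaleGradientL2Mixed
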